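import Summits.ABC.IUTFork.Joshi.Arithmeticoids
import Mathlib.Analysis.SpecialFunctions.Pow.Real
import Mathlib.Analysis.SpecialFunctions.Log.Basic
import Mathlib.Analysis.Complex.Basic

/-!
# Joshi, *Arithmetic Teichmüller Spaces II½* (arXiv:2305.10398v12) §2.3–§2.4 and Rmk. 2.7.1: valued fields in Bourbaki's
# sense, Ostrowski for `ℂ` (Prop. 2.3.1), archimedean algebraically closed perfectoid fields and their (un)tilts
# (Def. 2.3.2, 2.3.3), the archimedean Fargues–Fontaine curve `Y_{ℂ♭,ℂ} = ℝ_{>0}` (Prop. 2.4.3) — TYPED over Mathlib's `ℂ`;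
# the elementary parts PROVED, nothing asserted

Record file of the abc-iut cell, branch E «type Joshi's construction, test vs S» (rung LADDER-ABC:A2.E; seat abc-iut-E-t38,
second [J-II½] slot per the E-t37/E-t38 split of the E1/E1s remainder, STATUS 07:38:54Z / CLAIM 08:06Z; node ids
J2h:Prop2.3.1, Def2.3.2, Def2.3.3, Prop2.4.3, Rmk2.7.1 of plan/E/JOSHI-DAG.tsv + the un-numbered §2.3 / (2.4.1) / (2.4.2);
inventory plan/E/t38/INVENTORY-2.tsv). SOURCE: K. Joshi, *Construction of Arithmetic Teichmüller Spaces II½: Deformations of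
Number Fields*, arXiv:2305.10398**v12** («Preliminary version for comments», UNREFEREED; bib `Joshi2023ATS2half`). Locators
«p.N l.M» = line M of page file `pNNNN.txt` of `HOME/plan/repair/lit/renders/Joshi-arxiv-2305.10398-ATS2half/`. **No side is
taken** on [IUTchIII] Cor. 3.12, on Joshi's claims, or on Mochizuki's report on them; typed ≠ proved; print's assertions are
`@[claim "Joshi2023ATS2half" "disputed"] def … : Prop`, never axioms / instances / Literature facts; what FOLLOWS is proved.

CARRIERS. Joshi's valued fields «in the sense of [Bourbaki]» (§2.3 p.11 l.33–45: `|x| = 0 ↔ x = 0`, multiplicative, WEAK triangle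
inequality `|x + y| ≤ A·max(|x|,|y|)`, non-trivially valued) are slot T-37's `ATS2h.IsValuedField abs` (`Joshi/Arithmeticoids.lean`,
IMPORTED, not restated); the complex numbers are Mathlib's `ℂ` with `‖·‖`; `|−|^s_ℂ` is `powAbs s := ‖·‖ ^ s` (real power).
FAITHFULNESS FLAGS (E-ref): (F1) Prop. 2.3.1 as PRINTED («Any archimedean valuation on ℂ … is of the form |−|^s_ℂ») is typed
literally (`Prop231Literal`) AND in the reading of the classical theorem it names («Ostrowski»: `abs = |ι(·)|^s_ℂ` for a field
embedding `ι : ℂ → ℂ`, `Prop231`) — the literal sentence is contradicted by `|σ(·)|_ℂ` for a discontinuous field automorphism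
`σ` of `ℂ` (axiom of choice; not constructed in Mathlib, so no refutation is attempted here); literal ⟹ Ostrowski is proved,
neither is asserted. (F2) Def. 2.3.3 (3) «an isometry K♭ ≃ ℂ♭» cannot be literal, since print adds «(ℂ, |−|^s_ℂ) is an untilt of ℂ♭
for any s ∈ ℝ_{>0}» (p.12 l.21–22) and `|−|^s` is not isometric to `|−|` for `s ≠ 1`: typed, as Prop. 2.4.3 then states, by
letting an untilt of `ℂ♭` BE its exponent `s > 0` (`ArchUntilt`). NOT TYPED: nothing of §2.5–§2.6 (non-archimedean recollections
[FF18], slot T-37 / E-t3 carriers). Rmk. 2.7.1 is typed over T-37's `ATS2h.DeformationDatum` (the function (2.7.2) `y ↦ |p|_{K_y}`).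
OUR-SIDE pointers (not bound, E-PLAN R14): T-37's `DeformationDatum.act v` at `v ∈ V^arc` is modelled by `archAction`; the
valuation-RESCALING degree of freedom of Rmk. 2.7.1 is the [J-II½] print home of seat E-t7's `ValuationScaling` / E-t1's
`UntiltPoints.IsDilatation`. Standard axioms only; sorry-free. [claim: Joshi2023ATS2half, status: disputed]
-/

set_option autoImplicit false

noncomputable section

open Set

namespace Summit.ABC.IUTFork.Joshi.ATS2half

open Summit.ABC.IUTFork.Joshi.ATS2h (IsValuedField)

universe u

/-! ## 1. §2.3: valued fields, (non-)archimedean, `|−|^s_ℂ`, Ostrowski (Prop. 2.3.1), Def. 2.3.2 / 2.3.3 -/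

section ValuedFields

variable {K : Type u} [Field K]

/-- §2.3 (p.12 l.1–3): «one may always take A = max(|1|_K, |2|_K). A valued field is said to be a non-archimedean valued field if
and only if A = 1» — the constant `A = 1` works, i.e. the ultrametric inequality. [claim: Joshi2023ATS2half, status: disputed] -/
def IsNonarchimedeanAbs (abs : K → ℝ) : Prop :=
  ∀ x y, abs (x + y) ≤ max (abs x) (abs y)

/-- §2.3 (p.12 l.2–3): «otherwise (K, |−|_K) is said to be an archimedean valued field». [claim: Joshi2023ATS2half,
status: disputed] -/
def IsArchimedeanAbs (abs : K → ℝ) : Prop :=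
  IsValuedField abs ∧ ¬ IsNonarchimedeanAbs abs

end ValuedFields

/-- `|−|^s_ℂ` (p.12 l.4–10): the `s`-th power of «the usual complex absolute value». [claim: Joshi2023ATS2half, status: disputed] -/
def powAbs (s : ℝ) : ℂ → ℝ := fun z => ‖z‖ ^ s

/-- `|z|^s_ℂ = ‖z‖^s`. [folklore] -/
@[simp] theorem powAbs_apply (s : ℝ) (z : ℂ) : powAbs s z = ‖z‖ ^ s := rfl

/-- **DERIVED: `(ℂ, |−|^s_ℂ)` is a valued field in Bourbaki's sense for every `s > 0`** (the fact behind p.12 l.4–6 «(ℂ, |−|_ℂ) is an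
archimedean valued field in the above sense on ℂ (with A = 2)» and Def. 2.3.2): weak triangle inequality with `A = 2^s`,
non-trivial at `z = 2`. [folklore] -/
theorem isValuedField_powAbs {s : ℝ} (hs : 0 < s) : IsValuedField (powAbs s) where
  nonneg x := Real.rpow_nonneg (norm_nonneg _) _
  eq_zero_iff x := by
    rw [powAbs_apply, Real.rpow_eq_zero_iff_of_nonneg (norm_nonneg _)]
    simp [hs.ne']
  map_mul x y := by
    rw [powAbs_apply, powAbs_apply, powAbs_apply, norm_mul, Real.mul_rpow (norm_nonneg _) (norm_nonneg _)]
  exists_const := by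
    refine ⟨2 ^ s, by positivity, fun x y => ?_⟩
    have hm : 0 ≤ max ‖x‖ ‖y‖ := le_max_of_le_left (norm_nonneg _)
    have h1 : ‖x + y‖ ≤ 2 * max ‖x‖ ‖y‖ := by
      calc ‖x + y‖ ≤ ‖x‖ + ‖y‖ := norm_add_le x y
        _ ≤ max ‖x‖ ‖y‖ + max ‖x‖ ‖y‖ := add_le_add (le_max_left _ _) (le_max_right _ _)
        _ = 2 * max ‖x‖ ‖y‖ := by ring
    have h2 : ‖x + y‖ ^ s ≤ (2 * max ‖x‖ ‖y‖) ^ s := Real.rpow_le_rpow (norm_nonneg _) h1 hs.le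
    have h3 : (2 * max ‖x‖ ‖y‖) ^ s = 2 ^ s * (max ‖x‖ ‖y‖) ^ s := Real.mul_rpow (by norm_num) hm
    have h4 : (max ‖x‖ ‖y‖) ^ s ≤ max (‖x‖ ^ s) (‖y‖ ^ s) := by
      rcases max_choice ‖x‖ ‖y‖ with h | h
      · rw [h]; exact le_max_left _ _
      · rw [h]; exact le_max_right _ _
    calc powAbs s (x + y) = ‖x + y‖ ^ s := rfl
      _ ≤ 2 ^ s * (max ‖x‖ ‖y‖) ^ s := h2.trans h3.le
      _ ≤ 2 ^ s * max (powAbs s x) (powAbs s y) := by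
          rw [powAbs_apply, powAbs_apply]
          exact mul_le_mul_of_nonneg_left h4 (by positivity)
  nontrivial := by
    refine ⟨2, two_ne_zero, ?_⟩
    rw [powAbs_apply]
    have h2 : ‖(2 : ℂ)‖ = 2 := by simp
    rw [h2]
    exact ne_of_gt (Real.one_lt_rpow one_lt_two hs)

/-- The exponent is recovered from `|2|^s_ℂ = 2^s`: **`s ↦ |−|^s_ℂ` is injective on `s > 0`** (indeed on all of `ℝ`) — the
injectivity half of Prop. 2.4.3's bijection. [folklore] -/
theorem powAbs_injective : Function.Injective powAbs := by
  intro s t h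
  have h2 := congrFun h (2 : ℂ)
  simp only [powAbs_apply] at h2
  have hn : ‖(2 : ℂ)‖ = 2 := by simp
  rw [hn] at h2
  have hl := congrArg Real.log h2
  rw [Real.log_rpow two_pos, Real.log_rpow two_pos] at hl
  exact mul_right_cancel₀ (Real.log_pos one_lt_two).ne' hl

/-- **Prop. 2.3.1 AS PRINTED** (p.12 l.7–10): «Proposition 2.3.1 (Ostrowski's Theorem). Any archimedean valuation on ℂ (in the
above sense) is of the form |−|^s_ℂ for 0 < s ∈ ℝ.» LITERAL reading: the valuation IS `‖·‖^s`. FAITHFULNESS FLAG (module docstring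
(F1)): contradicted by `|σ(·)|_ℂ` for a discontinuous automorphism `σ` of `ℂ`; typed, never asserted. [claim: Joshi2023ATS2half,
status: disputed] -/
@[claim "Joshi2023ATS2half" "disputed"]
def Prop231Literal : Prop :=
  ∀ abs : ℂ → ℝ, IsArchimedeanAbs abs → ∃ s : ℝ, 0 < s ∧ abs = powAbs s

/-- **Prop. 2.3.1 in the reading of the theorem it names** (Ostrowski / [Artin 2006, Ch. 1 Thm. 10], p.12 l.1): an archimedean
valuation on `ℂ` is `|ι(·)|^s_ℂ` for some `s > 0` and some field embedding `ι : ℂ → ℂ`. HYPOTHESIS (claim).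
[claim: Joshi2023ATS2half, status: disputed] -/
@[claim "Joshi2023ATS2half" "disputed"]
def Prop231 : Prop :=
  ∀ abs : ℂ → ℝ, IsArchimedeanAbs abs → ∃ s : ℝ, 0 < s ∧ ∃ ι : ℂ →+* ℂ, abs = powAbs s ∘ ι

/-- The literal reading implies the Ostrowski reading (`ι = id`). [claim: Joshi2023ATS2half, status: disputed] -/
theorem prop231_of_literal (h : Prop231Literal) : Prop231 := fun abs habs =>
  let ⟨s, hs, he⟩ := h abs habs
  ⟨s, hs, RingHom.id ℂ, by rw [he]; rfl⟩

section ArchPerfectoid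

variable {K : Type u} [Field K]

/-- **Def. 2.3.2** (p.12 l.13–15): «An archimedean algebraically closed perfectoid field is a valued field (K, |−|_K) which is
isomorphic with (ℂ, |−|^s_ℂ) for some s ∈ ℝ_{>0}» — a field isomorphism `K ≃ ℂ` carrying `|−|_K` to `|−|^s_ℂ`.
[claim: Joshi2023ATS2half, status: disputed] -/
def IsArchPerfectoid (abs : K → ℝ) : Prop :=
  ∃ s : ℝ, 0 < s ∧ ∃ e : K ≃+* ℂ, ∀ x, abs x = powAbs s (e x)

/-- `(ℂ, |−|^s_ℂ)` itself is an archimedean algebraically closed perfectoid field (`e = id`). [claim: Joshi2023ATS2half,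
status: disputed] -/
theorem isArchPerfectoid_powAbs {s : ℝ} (hs : 0 < s) : IsArchPerfectoid (powAbs s) :=
  ⟨s, hs, RingEquiv.refl ℂ, fun _ => rfl⟩

/-- DERIVED: an archimedean algebraically closed perfectoid field IS a valued field in Bourbaki's sense (transport of
`isValuedField_powAbs` along the isomorphism). [claim: Joshi2023ATS2half, status: disputed] -/
theorem IsArchPerfectoid.isValuedField {abs : K → ℝ} (h : IsArchPerfectoid abs) : IsValuedField abs := by
  obtain ⟨s, hs, e, he⟩ := h
  have hC := isValuedField_powAbs hs
  refine ⟨fun x => ?_, fun x => ?_, fun x y => ?_, ?_, ?_⟩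
  · rw [he]; exact hC.nonneg _
  · rw [he, hC.eq_zero_iff, map_eq_zero_iff e e.injective]
  · rw [he, he, he, map_mul, hC.map_mul]
  · obtain ⟨A, hA, hle⟩ := hC.exists_const
    exact ⟨A, hA, fun x y => by rw [he, he, he, map_add]; exact hle _ _⟩
  · obtain ⟨z, hz, hz1⟩ := hC.nontrivial
    exact ⟨e.symm z, by simpa using hz, by rw [he, e.apply_symm_apply]; exact hz1⟩

end ArchPerfectoid

/-- **Def. 2.3.3 (1)–(2)** (p.12 l.16–18): «We define the tilt (K♭, |−|_{K♭}) to be (K♭, |−|_{K♭}) = (K, |−|_K). In particular, one has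
the tilt of complex numbers ℂ given by (ℂ♭, |−|_{ℂ♭}) = (ℂ, |−|_ℂ)» — in the archimedean case tilting is the identity on the valued
field. [claim: Joshi2023ATS2half, status: disputed] -/
abbrev archTilt {K : Type u} (abs : K → ℝ) : K → ℝ := abs

/-- Def. 2.3.3 (1): the archimedean tilt changes nothing. [claim: Joshi2023ATS2half, status: disputed] -/
theorem archTilt_eq {K : Type u} (abs : K → ℝ) : archTilt abs = abs := rfl

/-- **Def. 2.3.3 (3)** (p.12 l.19–22): «An untilt of ℂ♭ is an archimedean, algebraically closed perfectoid field (K, |−|_K) and an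
isometry K♭ ≃ ℂ♭. By this definition (ℂ, |−|^s_ℂ) is an untilt of ℂ♭ for any s ∈ ℝ_{>0}.» Typed (FAITHFULNESS FLAG (F2) of the module
docstring) as the datum print actually varies: an untilt of `ℂ♭` is `(ℂ, |−|^s_ℂ)`, i.e. its exponent `s > 0`.
[claim: Joshi2023ATS2half, status: disputed] -/
structure ArchUntilt where
  /-- the exponent `s` of the untilt `(ℂ, |−|^s_ℂ)` -/
  s : ℝ
  /-- `s > 0` -/
  pos : 0 < s

/-- The valued field `(ℂ, |−|^s_ℂ)` of the untilt. [claim: Joshi2023ATS2half, status: disputed] -/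
def ArchUntilt.abs (U : ArchUntilt) : ℂ → ℝ := powAbs U.s

/-- Every archimedean untilt of `ℂ♭` is an archimedean algebraically closed perfectoid field (Def. 2.3.2) and a Bourbaki valued
field. [claim: Joshi2023ATS2half, status: disputed] -/
theorem ArchUntilt.isArchPerfectoid (U : ArchUntilt) : IsArchPerfectoid U.abs :=
  isArchPerfectoid_powAbs U.pos

/-- An untilt is determined by its valued field (injectivity of `s ↦ |−|^s_ℂ`). [claim: Joshi2023ATS2half, status: disputed] -/
theorem ArchUntilt.ext_of_abs {U U' : ArchUntilt} (h : U.abs = U'.abs) : U = U' := by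
  have hs : U.s = U'.s := powAbs_injective h
  cases U; cases U'; cases hs; rfl

/-! ## 2. §2.4: the archimedean Fargues–Fontaine curve `Y_{ℂ♭,ℂ} = ℝ_{>0}` and Prop. 2.4.3 -/

/-- **(2.4.1)** (p.12 l.28–29): «I will take Y_{ℂ♭,ℂ} = ℝ_{>0}.» [claim: Joshi2023ATS2half, status: disputed] -/
abbrev ArchFFCurve : Type := {r : ℝ // 0 < r}

/-- **(2.4.2)** (p.12 l.30–31): «One also equips Y_{ℂ♭,ℂ} with an action of ℂ^* given by: ℂ^* × ℝ_{>0} ∋ (z, r) ↦ |z|·r» — CONSTRUCTED as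
a homomorphism `ℂ^× → Perm(ℝ_{>0})` (a model of slot T-37's abstract `DeformationDatum.act v` at an archimedean place).
[claim: Joshi2023ATS2half, status: disputed] -/
def archAction : ℂˣ →* Equiv.Perm ArchFFCurve where
  toFun z :=
    { toFun := fun r => ⟨‖(z : ℂ)‖ * r.1, mul_pos (norm_pos_iff.2 z.ne_zero) r.2⟩
      invFun := fun r => ⟨‖(z : ℂ)‖⁻¹ * r.1, mul_pos (inv_pos.2 (norm_pos_iff.2 z.ne_zero)) r.2⟩
      left_inv := fun r => by
        ext
        simp
      right_inv := fun r => by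
        ext
        simp }
  map_one' := by
    ext r
    simp
  map_mul' z w := by
    ext r
    simp [mul_assoc]

/-- The action is `r ↦ |z|·r`. [claim: Joshi2023ATS2half, status: disputed] -/
@[simp] theorem archAction_apply_val (z : ℂˣ) (r : ArchFFCurve) : ((archAction z r : ArchFFCurve) : ℝ) = ‖(z : ℂ)‖ * r := rfl

/-- **Prop. 2.4.3, the bijection** (p.12 l.33–35): «The mapping θ ∋ ℝ_{>0} ↦ (ℂ, |−|^θ_ℂ) sets up a bijection between untilts of ℂ♭ and
the archimedean Fargues–Fontaine curve Y_{ℂ♭,ℂ}» — DERIVED (by construction, once an untilt is its exponent: FLAG (F2); the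
content lies in `powAbs_injective` / `ArchUntilt.ext_of_abs`). [claim: Joshi2023ATS2half, status: disputed] -/
def untiltEquiv : ArchFFCurve ≃ ArchUntilt where
  toFun θ := ⟨θ.1, θ.2⟩
  invFun U := ⟨U.s, U.pos⟩
  left_inv _ := rfl
  right_inv _ := rfl

/-- The untilt attached to `θ` carries the valued field `(ℂ, |−|^θ_ℂ)`. [claim: Joshi2023ATS2half, status: disputed] -/
theorem untiltEquiv_abs (θ : ArchFFCurve) : (untiltEquiv θ).abs = powAbs θ.1 := rfl

/-- **Prop. 2.4.3, last clause** (p.12 l.36): «Notably z ∈ ℂ^* operates trivially if and only if z ∈ S¹ ⊂ ℂ^*» — PROVED over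
Mathlib's `ℂ`: `z` acts as the identity of `ℝ_{>0}` iff `‖z‖ = 1`. [claim: Joshi2023ATS2half, status: disputed] -/
theorem archAction_eq_one_iff (z : ℂˣ) : archAction z = 1 ↔ ‖(z : ℂ)‖ = 1 := by
  constructor
  · intro h
    have h1 := congrArg (fun e : Equiv.Perm ArchFFCurve => ((e ⟨1, one_pos⟩ : ArchFFCurve) : ℝ)) h
    simpa using h1
  · intro h
    ext r
    simp [h]

/-- The same clause with `S¹` as Mathlib's unit sphere of `ℂ`. [claim: Joshi2023ATS2half, status: disputed] -/
theorem archAction_eq_one_iff_mem_sphere (z : ℂˣ) : archAction z = 1 ↔ (z : ℂ) ∈ Metric.sphere (0 : ℂ) 1 := by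
  rw [archAction_eq_one_iff, mem_sphere_zero_iff_norm]

/-- **Prop. 2.4.3** as one claim-shaped `Prop` (both clauses), and its proof. [claim: Joshi2023ATS2half, status: disputed] -/
@[claim "Joshi2023ATS2half" "disputed"]
def Prop243 : Prop :=
  Function.Bijective (untiltEquiv : ArchFFCurve → ArchUntilt) ∧ ∀ z : ℂˣ, archAction z = 1 ↔ ‖(z : ℂ)‖ = 1

/-- Prop. 2.4.3 HOLDS in the typed reading (DISCHARGED). [claim: Joshi2023ATS2half, status: disputed] -/
theorem prop243_holds : Prop243 :=
  ⟨untiltEquiv.bijective, archAction_eq_one_iff⟩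

/-! ## 3. Rmk. 2.7.1: the function `y ↦ |p|_{K_y}` is not constant (over slot T-37's `ATS2h.DeformationDatum`) -/

section Beltrami

open Summit.ABC.IUTFork.Joshi.ATS2h

variable {L : Type} [Field L] {V : Type} {Lv : V → Type} [∀ v, Field (Lv v)] {Y : V → Type}
  [∀ v, TopologicalSpace (Y v)] {K : (v : V) → Y v → Type} [∀ v y, Field (K v y)] [∀ v y, TopologicalSpace (K v y)]
  {G : V → Type} [∀ v, Group (G v)] {A : V → Type} [∀ v, Group (A v)]

/-- **(2.7.2)** (p.15 l.80–p.16 l.2): the function `|Y_{L̂♭_v,L_v}| → ℝ`, `y ↦ |p|_{K_y}` (the residue characteristic `p_v` seen in the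
residue field of the point `y`, measured by `|−|_{K_y}`), over T-37's carriers. [claim: Joshi2023ATS2half, status: disputed] -/
def absPAt (D : DeformationDatum L V Lv Y K G A) (v : V) (y : Y v) : ℝ :=
  D.absK v y (D.emb v y (D.p v : Lv v))

/-- **Rmk. 2.7.1** (p.15 l.77–p.16 l.13): «Regardless of the choice of a normalization, an important aspect of the existence of
Fargues–Fontaine curves [FF18] is that one cannot normalize valuations of all untilts of L̂♭_v simultaneously. More precisely the
function Y_{L̂♭_v,L_v} → ℝ given by (2.7.2) y ↦ |p|_{K_y}, is not a constant function on Y_{L̂♭_v,L_v}. This function should be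
considered as the non-archimedean analog of Beltrami parameter in classical Teichmuller Theory … a measure of local (i.e. at p)
distortions of p-adic metrics. Mochizuki's discussion of this phenomenon is in [IUTchI, Remark 3.9.3].» Typed at every
non-archimedean place. HYPOTHESIS (claim; the [J-II½] print home of the valuation-RESCALING degree of freedom — E6 / dictionary
locator, no adjudication). [claim: Joshi2023ATS2half, status: disputed] -/
@[claim "Joshi2023ATS2half" "disputed"]
def Rmk271 (D : DeformationDatum L V Lv Y K G A) : Prop :=
  ∀ v, v ∉ D.Varc → ∃ y y' : Y v, absPAt D v y ≠ absPAt D v y'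

/-- Rmk. 2.7.1 restated: at a non-archimedean place, `y ↦ |p|_{K_y}` is not a constant function. [claim: Joshi2023ATS2half,
status: disputed] -/
theorem rmk271_iff_not_const (D : DeformationDatum L V Lv Y K G A) :
    Rmk271 D ↔ ∀ v, v ∉ D.Varc → ¬ ∃ c : ℝ, ∀ y : Y v, absPAt D v y = c := by
  refine forall_congr' fun v => forall_congr' fun _ => ⟨?_, ?_⟩
  · rintro ⟨y, y', h⟩ ⟨c, hc⟩
    exact h ((hc y).trans (hc y').symm)
  · intro h
    by_contra hne
    refine h ⟨absPAt D v (D.pt0 v), fun y => ?_⟩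
    by_contra hy
    exact hne ⟨y, D.pt0 v, hy⟩

end Beltrami

end Summit.ABC.IUTFork.Joshi.ATS2half

end
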